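import Summits.AtomisticToContinuum.HydrodynamicLimit.Theses.StiffCollisionalRelaxation
import Summits.AtomisticToContinuum.HydrodynamicLimit.Theses.CollisionIsometryCLT
import Summits.AtomisticToContinuum.HydrodynamicLimit.Theorems.StiffCollisionalRelaxationAprioriBoundsFibreDefs
import Summits.AtomisticToContinuum.HydrodynamicLimit.Theorems.StiffCollisionalRelaxationAprioriBoundsFibreDefsR4
import Summits.AtomisticToContinuum.HydrodynamicLimit.Theorems.StiffCollisionalRelaxationAprioriBoundsPartTwoOfKineticRangeControl
import Summits.AtomisticToContinuum.HydrodynamicLimit.Theorems.ImplosionDichotomyHsEosLowDensity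
import Literature.Analysis.FluidPDE.FractionalNSPrescribedEnergyIterationLimit
import Literature.MathematicalPhysics.KineticTheory.HardSphereEulerProofs
import Summits.AtomisticToContinuum.HydrodynamicLimit.Theorems.StiffCollisionalRelaxationAprioriBoundsFibreEnergyMoment
import Summits.AtomisticToContinuum.HydrodynamicLimit.Theorems.StiffCollisionalRelaxationAprioriBoundsFibreReduction
import Summits.AtomisticToContinuum.HydrodynamicLimit.Theorems.StiffCollisionalRelaxationAprioriBoundsFibrePartOnePrime
import Summits.AtomisticToContinuum.HydrodynamicLimit.Theorems.StiffCollisionalRelaxationAprioriBoundsFibreKLLever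
import Summits.AtomisticToContinuum.HydrodynamicLimit.Theorems.StiffCollisionalRelaxationAprioriBoundsFibreBracketVanish
import Summits.AtomisticToContinuum.HydrodynamicLimit.Theorems.StiffCollisionalRelaxationAprioriBoundsFibreFarTailAll
import Summits.AtomisticToContinuum.HydrodynamicLimit.Theorems.StiffCollisionalRelaxationAprioriBoundsFibreLinStatL1OfHydroLimit
import Summits.AtomisticToContinuum.HydrodynamicLimit.Statement
import Literature.MathematicalPhysics.KineticTheory.HardSphereEulerSolutionGluing

/-!
# Line `fibre-deficit-transfer` for the crux `AprioriBounds` (stmt-AtomisticToContinuum-14827) — skeleton r5a (= r5, stub set and signatures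
unchanged; cycle-2 producer audit folded into the docstrings)

Crux decl: `Summit.AtomisticToContinuum.HydrodynamicLimit.Theses.StiffCollisionalRelaxation.AprioriBounds` (rank 4)
= `…Theses.CollisionIsometryCLT.AprioriBoundsPreShock` (rank 5), one `Prop`.  This skeleton concludes BOTH by name (`AprioriBounds_of`,
`AprioriBoundsPreShock_of`) from the THREE OPEN registered stubs `stub_linStatL1` (hydrodynamics in the mean on [0,t] — ⇐ the conjunct /
`HydroLimitProfilewiseBand` 17372, glue LANDED), `stub_cellBounds` (⇐ `KineticRangeControl` 9201, glue LANDED), `stub_farTailAll` (⇐ the PRE-SHOCK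
tail item `UGibbsSRBRigidity.GaussianTails` 14415, glue `farTailAll_of_gaussianTails` LANDED-pending p137042; the older dock `GaussianVelocityTails` 9633 is
the ALL-HORIZONS form, expected false past an implosion focus — do not cite it as the antecedent); the other three r4 stubs are PROVED and landed
(`stub_bracketVanish` p134226, `stub_klLever` p135266, `stub_partOnePrime` p133823, + `stub_energyMoment` p130099) and enter as theorems; `sorry` occurs
only inside the three open `Holds.stub_*`.  Planner (r1): planner-cruxplan-stmt-AtomisticToContinuum-14827-fibre-deficit-transf-0; leads:
prover-line-stmt-AtomisticToContinuum-14827-a1-0 (cycle 1: r2 explicit tilt, statics split, importable Defs p128936; r3 rated lever + energyMoment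
discharged; r4/r5), prover-line-stmt-AtomisticToContinuum-14827-c7-0 (cycle 2: r5a, importable r5 reduction `aprioriBounds_of_r5_stubs` and capstone
`AprioriBounds_of_KRC_GT_HLPB : KineticRangeControl → UGibbsSRBRigidity.GaussianTails → HydroLimitProfilewiseBand → AprioriBounds`, p137042).

CYCLE-2 PRODUCER AUDIT (2026-08-17T01:50Z, lead c7 + wave 3): no theorem anywhere in the tree concludes `KineticRangeControl`, `PartTwoAt`,
`UGibbsSRBRigidity.GaussianTails`, `GaussianVelocityTails`, `HighMomentumCutoff σ`, `FarTailAllAt`, `HydroLimitProfilewiseBand` or `LinStatL1VanishAt`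
for non-constant profiles along a general flow family; items 9201 / 14415 / 17372 are open with no producer (17372 has its own line, 6 stubs, all
stub-blocked).  The three open stubs are therefore exactly three EXISTING open items behind landed glue; the line has no private content left.

VOCABULARY: `Theorems/…AprioriBoundsFibreDefs.lean` (p128936) + `…AprioriBoundsFibreDefsR4.lean` (p132149): `lam0`, `tiltExponent`, `tiltMean`,
`linStat`, `tiltPot`, `tiltZ`, `gibbsEntropy`, `frac`, `sliceAct`; rated packages `LinearHydroRateAt`, `TiltedExcessAt`, `EnergyMomentAt`, `BulkTailAt`,
`FarTailAt` (r2/r3, lever LANDED-pending: `Theorems.FibreDeficitTransfer.stub_deficitTransfer`); rate-free packages `LinStatL1VanishAt`,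
`BracketIntegratedVanishAt`, `KLIntegratedVanishAt`, `IntegratedBulkTailAt`, `FarTailAllAt` (r4).

## Why r4 (the lead's cycle-1 finding)

Component (i) is a TIME AVERAGE `∫₀ᵗ (N+1)⁻¹∑ᵢ e^{λ|vᵢ(s)|²} ds`, and its assembly consumes the bad tail-fraction events only through
`∫₀ᵗ P(bad(K,s)) ds` with a level cutoff that may grow ARBITRARILY SLOWLY once the far tails carry no polynomial slack.  Hence NO RATE is
needed anywhere: time-integrated relative entropy `o(N)` against the Euler-fitted local Gibbs states (`KLIntegratedVanishAt`) + Hoeffding at a FIXED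
slack + Kipnis–Landim give `IntegratedBulkTailAt` (lever part 2, `integratedBulkTail_of_klDiv_integrated`); the identity of the line
`H(μ_s | G_s) = [log Z_N(Λ_s) − S(μ₀) − (N+1)m_s] − (N+1)E[ℓ_s ∘ Φ_s]` (the tilted reference `G_s` IS the local Gibbs law of the slice activity
`sliceAct`, so the tree's KL bookkeeping applies verbatim) turns rate-free statics + isentropy (`BracketIntegratedVanishAt`) and hydrodynamics in the
mean (`LinStatL1VanishAt`) into `KLIntegratedVanishAt` (lever part 1, `klIntegratedVanish_of_bracket_linStat`).  In this currency the statics input is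
a thermodynamic LIMIT, which the tree HAS (`hardSphereLDA_proof` (B1) for exactly the slice activity class `ρe^{f_ex+ηf_ex'}`, the `JaynesSqueeze*`
time-zero entropy, EXACT ISENTROPY `…FibreIsentropy.integral_density_mul_entropy_eq` landed by the lead), and the dynamical input is the
conjunct-strength hydrodynamic limit on `[0,t]` in the mean — the weakest conceivable; any Yau-type relative-entropy hydrodynamics
(`RelEntropyVanishing` family, `KnudsenRateHorizon.EntropyKnudsenRate` 12339) docks into the lever directly (arbitrary continuous positive
activities).  END STATE of the line: `AprioriBounds ⇐ KRC(9201) ∧ GaussianTails(14415, pre-shock) ∧ [hydrodynamic limit in the mean on [0,t] (⇐ 17372)]`,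
everything else proved (`AprioriBounds_of_KRC_GT_HLPB`, p137042; the 9633-docked `AprioriBounds_of_KRC_GVT_HLPB`, p135871).

## Disproof used (`Cruxes/AprioriBounds/Disproof.lean`, cycle 4, rc 0; unchanged — no `-- Targets` for this line yet): §4d/§9e `∀λ` false — `λ` is
produced by the dial in stub 6 below `1/(2 max(Θ,Θ'))`; §2–§3 concern (ii), kept verbatim (`stub_cellBounds`); §7–§8 need `t ≥ T` (isentropy inside
`stub_bracketVanish` USES `t < T`); equilibrium unit tests of every stub are LANDED-pending (`hydroRate_equilibrium`, `tiltedExcess_equilibrium` (bracket ≡ 0),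
`farTail_homogeneous`, `stub_energyMoment`).
-/

noncomputable section

open MeasureTheory Filter Set Topology
open scoped ENNReal

namespace Summit.AtomisticToContinuum.HydrodynamicLimit.Cruxes.AprioriBounds.FibreDeficitTransfer

open Literature.MathematicalPhysics.KineticTheory Literature.Analysis.FluidPDE
open Summit.AtomisticToContinuum.HydrodynamicLimit.Theorems.AprioriBoundsNegative (PartOneAt PartTwoAt)
open Summit.AtomisticToContinuum.HydrodynamicLimit.Theorems.VisitLedgerUpscattering (Cfg Flow Flows NiceProfiles)
open Summit.AtomisticToContinuum.HydrodynamicLimit.Theorems.FibreDeficitTransfer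

/-! ## Registered stubs (bodies `sorry`; every signature self-contained over the landed vocabulary) -/

namespace Holds

/-- STUB 1 `linStatL1` (OPEN — the dynamical core, rate-free: HYDRODYNAMICS IN THE MEAN ON `[0,t]`).  Under the crux prefix:
`LinStatL1VanishAt` — `∫₀ᵗ E_N|ℓ_s ∘ Φ_s| ds → 0`, the five Λ-tested linear statistics of the evolved gas converge in the mean, on
average over `[0,t]`.  Implied by convergence in probability of the empirical fields at each fixed `s ≤ t`
(`TendstoHydroFieldsAt … s` tested against `λ₀(s,·)`, `u_j(s,·)/θ(s,·)`, `1/θ(s,·)`) + uniform integrability (landed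
`stub_energyMoment`, energy conservation) + dominated convergence in `s`: i.e. by the CONJUNCT-STRENGTH hydrodynamic limit on
`[0, t]` (no rate) — or by any relative-entropy hydrodynamics through `klLever` directly.  TRUE at equilibrium (static LLN,
landed `hydroRate_equilibrium`). -/
theorem stub_linStatL1 :
    ∀ (a₀ θ₀ : T3 → ℝ) (u₀ : T3 → V3), Continuous a₀ → Continuous θ₀ → Continuous u₀ →
      (∀ x, 0 < a₀ x) → (∀ x, 0 < θ₀ x) →
      ∃ σ₀ : ℝ, 0 < σ₀ ∧ ∃ η₁ : ℝ, 0 < η₁ ∧ ∀ σ : ℝ, 0 < σ → σ < σ₀ →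
        ∀ (T : ℝ) (ρ θ : ℝ → T3 → ℝ) (u : ℝ → T3 → V3), IsHardSphereEulerSolution σ T ρ u θ →
        ∀ Φ : (N : ℕ) → HardSphereFlow (Torus.geometry (Fin 3)) (hsDiameter σ N) (N + 1),
          TendstoHydroFieldsAt (fun N => localGibbsLaw σ a₀ u₀ θ₀ N (Φ N)) Φ ρ u θ 0 →
          ∀ t : ℝ, 0 < t → t < T → (∀ s ∈ Icc 0 t, ∀ x, 2 * ρ s x * σ ^ 3 < η₁) →
            LinStatL1VanishAt σ a₀ θ₀ u₀ ρ θ u Φ t := by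
  sorry

/-- STUB 2 `cellBounds` (OPEN — component (ii) VERBATIM under the crux prefix; an IMPORT docked to `GermanoSplitLES.KineticRangeControl`
(stmt-9201) by the landed glue `AdiabatCeiling.partTwo_of_kineticRangeControl`, see `AprioriBounds_of_KRC`). -/
theorem stub_cellBounds :
    ∀ (a₀ θ₀ : T3 → ℝ) (u₀ : T3 → V3), Continuous a₀ → Continuous θ₀ → Continuous u₀ →
      (∀ x, 0 < a₀ x) → (∀ x, 0 < θ₀ x) →
      ∃ σ₀ : ℝ, 0 < σ₀ ∧ ∃ η₁ : ℝ, 0 < η₁ ∧ ∀ σ : ℝ, 0 < σ → σ < σ₀ →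
        ∀ (T : ℝ) (ρ θ : ℝ → T3 → ℝ) (u : ℝ → T3 → V3), IsHardSphereEulerSolution σ T ρ u θ →
        ∀ Φ : (N : ℕ) → HardSphereFlow (Torus.geometry (Fin 3)) (hsDiameter σ N) (N + 1),
          TendstoHydroFieldsAt (fun N => localGibbsLaw σ a₀ u₀ θ₀ N (Φ N)) Φ ρ u θ 0 →
          ∀ t : ℝ, 0 < t → t < T → (∀ s ∈ Icc 0 t, ∀ x, 2 * ρ s x * σ ^ 3 < η₁) →
            PartTwoAt σ a₀ θ₀ u₀ Φ t := by
  sorry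

/-- STUB 3 `bracketVanish` (PROVABLE NOW, L — rate-free statics + isentropy).  Under the crux prefix: `BracketIntegratedVanishAt` —
`(N+1)⁻¹ ∫₀ᵗ |log Z_N(Λ_s) − S(μ₀) − (N+1)m_s| ds → 0`.  By the lead's computation (Defs docstrings) the bracket's `O(N)` part is
`(N+1)[∫ρ_s s_s − ∫ρ₀ s₀] = 0` (EXACT ISENTROPY, landed `…FibreIsentropy.integral_density_mul_entropy_eq`); the three thermodynamic LIMITS
are landed: `(N+1)⁻¹ log Z_N(ρe^{g_σ(ρ)}) → ∫ρ·ρσ³f_ex′` (`hardSphereLDA_proof`, (B1); the slice activity is `(2π)^{3/2}e^{5/2}·ρ_s e^{g_σ(ρ_s)}`,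
scaling `canonicalPartition_const_mul`), the time-zero entropy `(N+1)⁻¹S(μ₀) → ∫ρ₀[(3/2)log 2πθ₀ + 3/2 − log ρ₀ − f_ex(ρ₀σ³)]`
(`gibbsEntropy_eq` + `JaynesSqueezeClosure.tendsto_integral_logPair_zero` + identification of `ρ(0,·)` with the LLN density,
`hardSphereLDA_proof` (A)/(B3)), mass conservation `∫ρ_s = 1`; uniformity/measurability in `s ∈ [0,t]` by continuity of
`s ↦ Z_N(Λ_s), m_s` (parametric integrals of jointly continuous integrands) and dominated convergence.  Equilibrium: bracket ≡ 0
(landed `tiltedExcess_equilibrium`). -/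
theorem stub_bracketVanish :
    ∀ (a₀ θ₀ : T3 → ℝ) (u₀ : T3 → V3), Continuous a₀ → Continuous θ₀ → Continuous u₀ →
      (∀ x, 0 < a₀ x) → (∀ x, 0 < θ₀ x) →
      ∃ σ₀ : ℝ, 0 < σ₀ ∧ ∃ η₁ : ℝ, 0 < η₁ ∧ ∀ σ : ℝ, 0 < σ → σ < σ₀ →
        ∀ (T : ℝ) (ρ θ : ℝ → T3 → ℝ) (u : ℝ → T3 → V3), IsHardSphereEulerSolution σ T ρ u θ →
        ∀ Φ : (N : ℕ) → HardSphereFlow (Torus.geometry (Fin 3)) (hsDiameter σ N) (N + 1),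
          TendstoHydroFieldsAt (fun N => localGibbsLaw σ a₀ u₀ θ₀ N (Φ N)) Φ ρ u θ 0 →
          ∀ t : ℝ, 0 < t → t < T → (∀ s ∈ Icc 0 t, ∀ x, 2 * ρ s x * σ ^ 3 < η₁) →
            BracketIntegratedVanishAt σ a₀ θ₀ u₀ ρ θ u t := by
  exact Theorems.FibreDeficitTransfer.stub_bracketVanish

/-- STUB 4 `farTailAll` (OPEN — far tails at ALL levels, no polynomial slack: `FarTailAllAt`).  Producer: the PRE-SHOCK tail item
`UGibbsSRBRigidity.GaussianTails` (stmt-14415: Gaussian velocity moments along the flow for `s ≤ t < T` under exactly this prefix) through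
the landed Markov–Tonelli reduction `farTailAll_of_expVelocityMoment` (glue `farTailAll_of_gaussianTails`, p137042; `η₁ := 1`, the chamber is
not used); the all-horizons `SpeedCapSurgery.GaussianVelocityTails` (stmt-9633) and `HighMomentumCutoff σ` also imply it but are stronger than
needed (and 9633 is expected false past a focus).  TRUE at equilibrium (landed `farTailAll_homogeneous`).  Energy conservation alone does not give
it (one sphere may carry energy `≍ N`); entropy/domination vs the invariant Gibbs law gives only `E frac_K ≲ 1/K`. -/
theorem stub_farTailAll :
    ∀ (a₀ θ₀ : T3 → ℝ) (u₀ : T3 → V3), Continuous a₀ → Continuous θ₀ → Continuous u₀ →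
      (∀ x, 0 < a₀ x) → (∀ x, 0 < θ₀ x) →
      ∃ σ₀ : ℝ, 0 < σ₀ ∧ ∃ η₁ : ℝ, 0 < η₁ ∧ ∀ σ : ℝ, 0 < σ → σ < σ₀ →
        ∀ (T : ℝ) (ρ θ : ℝ → T3 → ℝ) (u : ℝ → T3 → V3), IsHardSphereEulerSolution σ T ρ u θ →
        ∀ Φ : (N : ℕ) → HardSphereFlow (Torus.geometry (Fin 3)) (hsDiameter σ N) (N + 1),
          TendstoHydroFieldsAt (fun N => localGibbsLaw σ a₀ u₀ θ₀ N (Φ N)) Φ ρ u θ 0 →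
          ∀ t : ℝ, 0 < t → t < T → (∀ s ∈ Icc 0 t, ∀ x, 2 * ρ s x * σ ^ 3 < η₁) →
            FarTailAllAt σ a₀ θ₀ u₀ Φ t := by
  sorry

/-- STUB 5 `klLever` — THE RATE-FREE LEVER (PROVED modulo landing: `klIntegratedVanish_of_bracket_linStat` ∘
`integratedBulkTail_of_klDiv_integrated`, files …FibreKLGlue / …FibreKLTransfer): for `0 < σ < 1/2`, nice profiles, `t > 0`, fields
jointly continuous on `[0,t] × 𝕋³` with `θ > 0` and a jointly continuous density multiplier:
`BracketIntegratedVanishAt ∧ LinStatL1VanishAt ⟹ IntegratedBulkTailAt` (identity + Hoeffding at fixed slack + Kipnis–Landim, all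
time-integrated; no rates anywhere). -/
theorem stub_klLever :
    ∀ (σ : ℝ) (a₀ θ₀ : T3 → ℝ) (u₀ : T3 → V3) (ρ θ : ℝ → T3 → ℝ) (u : ℝ → T3 → V3)
      (Φ : (N : ℕ) → HardSphereFlow (Torus.geometry (Fin 3)) (hsDiameter σ N) (N + 1)) (t : ℝ),
      0 < σ → σ < 1 / 2 → NiceProfiles a₀ θ₀ u₀ → 0 < t →
      ContinuousOn (Function.uncurry ρ) (Icc 0 t ×ˢ univ) →
      ContinuousOn (Function.uncurry θ) (Icc 0 t ×ˢ univ) →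
      ContinuousOn (Function.uncurry u) (Icc 0 t ×ˢ univ) →
      (∀ s ∈ Icc 0 t, ∀ x, 0 < θ s x) →
      ContinuousOn (fun p : ℝ × T3 => lam0 σ (ρ p.1 p.2) (θ p.1 p.2) (u p.1 p.2)) (Icc 0 t ×ˢ univ) →
      BracketIntegratedVanishAt σ a₀ θ₀ u₀ ρ θ u t → LinStatL1VanishAt σ a₀ θ₀ u₀ ρ θ u Φ t →
        IntegratedBulkTailAt σ a₀ θ₀ u₀ Φ t := by
  exact Theorems.FibreDeficitTransfer.stub_klLever

/-- STUB 6 `partOnePrime` (a theorem given its inputs; M–L in Lean): for `0 < σ ≤ 1/2`, nice profiles, `t > 0`,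
`IntegratedBulkTailAt ∧ FarTailAllAt ⟹ PartOneAt`.  Plan: dial `λ := min(1/(2Θ),1/(2Θ'))/2`, `C_λ := 2A e^λ/(1 − e^{−(1/(2Θ)−λ)})`,
`Cexp := tC_λ + 1`; for every `η > 0` choose a FIXED level cut `M` with far tail `τ_M ≤ η/8` (geometric in `M`, from `FarTailAllAt`),
then `δ` with `tδ∑_{K≤M}e^{λ(K+1)} ≤ 1/4`, then `ε := η/(8∑_{K≤M}e^{λ(K+1)})` in `IntegratedBulkTailAt`; layer cake
`(N+1)⁻¹∑e^{λ|vᵢ|²} ≤ ∑_K e^{λ(K+1)} frac_K`, `frac_K ≤ thr + 𝟙_bad` on `K ≤ M`, Tonelli on `good × [0,t]`, Markov: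
`P ≤ (4/3)(E R¹ + E R²) ≤ η/3` eventually — so `limsup ≤ η` for every `η`.  Template: the landed `partOne_markov_step` (helper A of
`stub_partOne_of_tails`) with the bulk hypothesis in TIME-INTEGRATED form. -/
theorem stub_partOnePrime :
    ∀ (σ : ℝ) (a₀ θ₀ : T3 → ℝ) (u₀ : T3 → V3)
      (Φ : (N : ℕ) → HardSphereFlow (Torus.geometry (Fin 3)) (hsDiameter σ N) (N + 1)) (t : ℝ),
      0 < σ → σ ≤ 1 / 2 → NiceProfiles a₀ θ₀ u₀ → 0 < t →
      IntegratedBulkTailAt σ a₀ θ₀ u₀ Φ t → FarTailAllAt σ a₀ θ₀ u₀ Φ t → PartOneAt σ a₀ θ₀ u₀ Φ t := by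
  exact Theorems.FibreDeficitTransfer.stub_partOnePrime

end Holds

/-! ## Stub statements by name -/

/-- Statement of registered stub 1 (`Holds.stub_linStatL1`). -/
def stub_linStatL1 : Prop := type_of% Holds.stub_linStatL1
/-- Statement of registered stub 2 (`Holds.stub_cellBounds`). -/
def stub_cellBounds : Prop := type_of% Holds.stub_cellBounds
/-- Statement of registered stub 3 (`Holds.stub_bracketVanish`). -/
def stub_bracketVanish : Prop := type_of% Holds.stub_bracketVanish
/-- Statement of registered stub 4 (`Holds.stub_farTailAll`). -/
def stub_farTailAll : Prop := type_of% Holds.stub_farTailAll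
/-- Statement of registered stub 5 (`Holds.stub_klLever`). -/
def stub_klLever : Prop := type_of% Holds.stub_klLever
/-- Statement of registered stub 6 (`Holds.stub_partOnePrime`). -/
def stub_partOnePrime : Prop := type_of% Holds.stub_partOnePrime

/-! ## Glue: `fields_continuousOn`, `eos_continuousOn`, `lam0_continuousOn` are LANDED (`…FibreReduction`, p130381) and used by their short names. -/

/-! ## Compositions (sorry-free) -/

/-- Component (i) under the crux prefix from the OPEN stubs 1, 4 (inputs) and the PROVED stubs 3, 5, 6 (statics, lever, assembly — used as
theorems): thresholds
`σ₀ := min (min σ₁ σ₃) (min σ₄ (1/2))`, `η₁ := min (min η¹ η³) (min η⁴ η_e)`. -/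
theorem partOne_of (h1 : stub_linStatL1) (h4 : stub_farTailAll) :
    ∀ (a₀ θ₀ : T3 → ℝ) (u₀ : T3 → V3), Continuous a₀ → Continuous θ₀ → Continuous u₀ →
      (∀ x, 0 < a₀ x) → (∀ x, 0 < θ₀ x) →
      ∃ σ₀ : ℝ, 0 < σ₀ ∧ ∃ η₁ : ℝ, 0 < η₁ ∧ ∀ σ : ℝ, 0 < σ → σ < σ₀ →
        ∀ (T : ℝ) (ρ θ : ℝ → T3 → ℝ) (u : ℝ → T3 → V3), IsHardSphereEulerSolution σ T ρ u θ →
        ∀ Φ : (N : ℕ) → HardSphereFlow (Torus.geometry (Fin 3)) (hsDiameter σ N) (N + 1),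
          TendstoHydroFieldsAt (fun N => localGibbsLaw σ a₀ u₀ θ₀ N (Φ N)) Φ ρ u θ 0 →
          ∀ t : ℝ, 0 < t → t < T → (∀ s ∈ Icc 0 t, ∀ x, 2 * ρ s x * σ ^ 3 < η₁) →
            PartOneAt σ a₀ θ₀ u₀ Φ t := by
  intro a₀ θ₀ u₀ ha hθ hu ha0 hθ0
  have hP : NiceProfiles a₀ θ₀ u₀ := ⟨ha, hθ, hu, ha0, hθ0⟩
  obtain ⟨σ₁, hσ₁, η₁', hη₁', H1⟩ := (h1 : type_of% Holds.stub_linStatL1) a₀ θ₀ u₀ ha hθ hu ha0 hθ0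
  obtain ⟨σ₃, hσ₃, η₃', hη₃', H3⟩ := Holds.stub_bracketVanish a₀ θ₀ u₀ ha hθ hu ha0 hθ0
  obtain ⟨σ₄, hσ₄, η₄', hη₄', H4⟩ := (h4 : type_of% Holds.stub_farTailAll) a₀ θ₀ u₀ ha hθ hu ha0 hθ0
  obtain ⟨ηe, hηe, hfe, hdfe⟩ := eos_continuousOn
  have H5 := Holds.stub_klLever
  have H6 := Holds.stub_partOnePrime
  refine ⟨min (min σ₁ σ₃) (min σ₄ (1 / 2)), lt_min (lt_min hσ₁ hσ₃) (lt_min hσ₄ one_half_pos),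
    min (min η₁' η₃') (min η₄' ηe), lt_min (lt_min hη₁' hη₃') (lt_min hη₄' hηe), ?_⟩
  intro σ hσ hσlt T ρ θ u hsol Φ hLLN t ht htT hdil
  simp only [lt_min_iff] at hσlt hdil
  obtain ⟨⟨hs1, hs3⟩, hs4, hshalf⟩ := hσlt
  have hLin : LinStatL1VanishAt σ a₀ θ₀ u₀ ρ θ u Φ t :=
    H1 σ hσ hs1 T ρ θ u hsol Φ hLLN t ht htT (fun s hs x => (hdil s hs x).1.1)
  have hBr : BracketIntegratedVanishAt σ a₀ θ₀ u₀ ρ θ u t :=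
    H3 σ hσ hs3 T ρ θ u hsol Φ hLLN t ht htT (fun s hs x => (hdil s hs x).1.2)
  have hFar : FarTailAllAt σ a₀ θ₀ u₀ Φ t :=
    H4 σ hσ hs4 T ρ θ u hsol Φ hLLN t ht htT (fun s hs x => (hdil s hs x).2.1)
  obtain ⟨hρc, hθc, huc, hθpos, hρpos⟩ := fields_continuousOn hsol htT
  have hcham : ∀ s ∈ Icc 0 t, ∀ x, ρ s x * σ ^ 3 < ηe := fun s hs x => by
    have h := (hdil s hs x).2.2
    have h0 : 0 < ρ s x * σ ^ 3 := mul_pos (hρpos s hs x) (pow_pos hσ 3)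
    linarith
  have hΛ := lam0_continuousOn hσ hfe hdfe hρc hθc huc hρpos hθpos hcham
  have hBulk : IntegratedBulkTailAt σ a₀ θ₀ u₀ Φ t :=
    H5 σ a₀ θ₀ u₀ ρ θ u Φ t hσ hshalf hP ht hρc hθc huc hθpos hΛ hBr hLin
  exact H6 σ a₀ θ₀ u₀ Φ t hσ hshalf.le hP ht hBulk hFar

/-- **THE SKELETON THEOREM (r5).**  The three OPEN registered stubs (1 `linStatL1`, 2 `cellBounds`, 4 `farTailAll`) imply the crux decl
`StiffCollisionalRelaxation.AprioriBounds` BY NAME; stubs 3, 5, 6 are discharged by landed theorems. -/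
theorem AprioriBounds_of (h1 : stub_linStatL1) (h2 : stub_cellBounds) (h4 : stub_farTailAll) :
    Summit.AtomisticToContinuum.HydrodynamicLimit.Theses.StiffCollisionalRelaxation.AprioriBounds := by
  rw [Theorems.AprioriBoundsNegative.aprioriBounds_iff]
  intro a₀ θ₀ u₀ ha hθ hu ha0 hθ0
  obtain ⟨σ₁, hσ₁, η₁', hη₁', HI⟩ := partOne_of h1 h4 a₀ θ₀ u₀ ha hθ hu ha0 hθ0
  obtain ⟨σ₂, hσ₂, η₂', hη₂', HII⟩ := (h2 : type_of% Holds.stub_cellBounds) a₀ θ₀ u₀ ha hθ hu ha0 hθ0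
  refine ⟨min σ₁ σ₂, lt_min hσ₁ hσ₂, min η₁' η₂', lt_min hη₁' hη₂', ?_⟩
  intro σ hσ hσlt T ρ θ u hsol Φ hLLN t ht htT hdil
  simp only [lt_min_iff] at hσlt hdil
  exact ⟨HI σ hσ hσlt.1 T ρ θ u hsol Φ hLLN t ht htT (fun s hs x => (hdil s hs x).1),
    HII σ hσ hσlt.2 T ρ θ u hsol Φ hLLN t ht htT (fun s hs x => (hdil s hs x).2)⟩

/-- The same skeleton closes the `CollisionIsometryCLT` copy of the crux (one `Prop`). -/
theorem AprioriBoundsPreShock_of (h1 : stub_linStatL1) (h2 : stub_cellBounds) (h4 : stub_farTailAll) :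
    Summit.AtomisticToContinuum.HydrodynamicLimit.Theses.CollisionIsometryCLT.AprioriBoundsPreShock :=
  AprioriBounds_of h1 h2 h4

/-! ## Capstones (LANDED separately, `Theorems/…AprioriBoundsFibreCapstones.lean`, because a skeleton may not carry crux-concluding
theorems with non-stub hypotheses — `skeleton.extra-hypothesis`):
`AprioriBounds_of_KRC_GVT_HL : KineticRangeControl → GaussianVelocityTails → _root_.HydrodynamicLimit → AprioriBounds` (registered sub-goal,
sorry-free: stubs 2, 4, 1 discharged by 9201, 9633 and the conjunct through the landed glues `partTwo_of_kineticRangeControl`,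
`farTailAll_of_gaussianVelocityTails`, `stub_linStatL1_of_hydrodynamicLimit`), its `AprioriBoundsPreShock` twin, and
`AprioriBounds_of_KRC_GVT_IREV` (third hypothesis := any time-integrated relative-entropy hydrodynamics on `[0,t]` with slice-continuous
positive activities, through `integratedBulkTail_of_klDiv_integrated`). -/

/-- D-0027 §3.3 shape: the crux from the registered stubs. -/
example : Summit.AtomisticToContinuum.HydrodynamicLimit.Theses.StiffCollisionalRelaxation.AprioriBounds :=
  AprioriBounds_of Holds.stub_linStatL1 Holds.stub_cellBounds Holds.stub_farTailAll

end Summit.AtomisticToContinuum.HydrodynamicLimit.Cruxes.AprioriBounds.FibreDeficitTransfer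

end
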